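import Summits.QuantumFields.BalabanUV.T4Continuum.Support.NE7ExistenceByInduction
import HarnessLib

/-!
# NE7ApeOfHalvingIteration — [Balaban1985Variational] Prop. 8's LAST STEP in kernel: the a-priori estimate with gain (`hape` of F31 ∕ F33) follows from a
# ONE-SHOT CONTRACTIVE LOCAL IMPROVEMENT «radius `r` ⟹ radius `max{rf, θ·r}`» (`θ < 1`, datum floor `rf > 0`) by iteration — p. 304: «If ½ε₀ > B₃ε₁, then we
# apply again the whole reasoning with ½ε₀ instead of ε₀. We continue this way until we reach the bound B₃ε₁»

Cell `pub-balaban`, rung (B)+1 sub-cell t4, lineage `b2b-balaban-t4-ne7-p1` (CRUX PROVER NE7 #1 = OWNER of row NE7), generation 88; memo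
`t4/b2b-balaban-t4-ne7-p1-g88/EXISTENCE-BY-INDUCTION.md` §0(A), §5 (SF5).  File F242 (over the tree's classes only; no analytic input).

WHY.  Gen 88's print read: `hape` IS [B11] Prop. 8 p. 304, and Sect. F proves it by a LOCAL FLAT estimate (167)–(168) that improves the radius `ε₀` of a critical
configuration to `max{B₃ε₁, ½ε₀}` (datum part + exponentially discounted far part + quadratic fixed-point part `≤ ¼ε₀ + ¼ε₀`), followed by the ITERATION quoted in
the title.  THIS FILE is that iteration, abstractly: whatever supplies the one-shot improvement `himp` (Sect. F's (SF1)–(SF5) of the memo: axial gauge on a fixed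
cube, [B8] Thm 2 at `U₀ = 1` on nested cubes, B5∕B6 flat operators with decay, the algebra) supplies `hape` — the improvement need NOT reach the target radius in one
shot, only CONTRACT (`θ < 1`) above the datum floor `rf`.
WHAT ([folklore] real-analysis iteration over the tree's classes; 0 def, 0 sorry).
§1 `smallField_iterate_of_improvement` — for ONE configuration: if `SmallField U (r∕M²)` improves to `SmallField U (max rf (θr)∕M²)` for every `r ∈ [rf, δ]`, then
   `SmallField U (δ∕M²) ⟹ SmallField U (max rf (θⁿδ)∕M²)` for every `n`, hence (`θ < 1`, `rf > 0`, `exists_pow_lt_of_lt_one`) `SmallField U (rf∕M²)`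
   (`smallField_floor_of_improvement`).
§2 **`hape_of_contractiveImprovement`** — on the data class: `himp` (per datum `D ∈ 𝒟_β`, level `k+1`, admissible tangent-critical `U`, every `r ∈ [rf, δ]`) ⟹ F31's
   `hape` with ANY `δ₁ ≥ rf` — literally the hypothesis `hape` of `NE7OneStepOfRoutePi.oneStep_of_dataClass_ape_routePi` ∕ F33.
HONEST FRAMING (page 1): iteration bookkeeping; `himp` ([B11] Sect. F (167)–(168) TYPE) is a HYPOTHESIS asserted for nothing; nothing of Bałaban's asserted — p. 304 is
quoted for the ARCHITECTURE; NOT (APE), NOT ONE-STEP, NOT NE7; spine 0∕9; finite T⁴ rung (B)+1 — NOT infinite volume, NOT mass gap, NOT `BetaPertH`, NOT Clay.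
Continuum YM on T⁴ ⇐ BetaPertH ∧ nine spine estimates (0/9 proved); BetaPertH ⇐ (D1) ∧ (D4) ∧ CAP+tail; G-an2-4 gates asym, D1 and NE2/3/4.
-/

set_option autoImplicit false

open scoped BigOperators Matrix Matrix.Norms.L2Operator
open NormedSpace Finset

namespace Summit.QuantumFields.BalabanUV.T4Continuum.NE7ApeOfHalvingIteration

open Literature.MathematicalPhysics.QuantumFieldTheory.Balaban1983to89
open B7Prop1Explicit B7Prop2Explicit
open T4AveragingDeficitWall (IsUnitaryCfg IsSkewDir SmallField)
open T4AveragingDeficitWallBoundary (IsPeriodicCfg)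
open AveragingDeficitPeriodicCounting (IsPeriodicDir)
open AveragingDeficitMultiLevelPrep (TangentIter)
open MinimalActionLevels (perWin)
open MinimalActionSandwich (admissible)
open MinimalActionRate (sfClass)
open NE3HessForm (dAction)

noncomputable section

variable {d : ℕ} {n : Type*} [Fintype n] [DecidableEq n]

/-! ## §1 One configuration: iterate the contractive improvement down to the floor -/

/-- **ITERATING A CONTRACTIVE IMPROVEMENT** (one configuration `U`, scale factor `S > 0` — in use `S = M² = (L^{k+1})²`): if for every `r ∈ [rf, δ]` the radius `r∕S`
improves to `max rf (θr)∕S`, then `SmallField U (δ∕S)` gives `SmallField U (max rf (θⁿδ)∕S)` for every `n`. [folklore] -/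
theorem smallField_iterate_of_improvement {U : Site d → Fin d → (Matrix n n ℂ)ˣ} {S rf θ δ : ℝ} (hS : 0 < S) (hθ0 : 0 ≤ θ) (hθ1 : θ ≤ 1)
    (hrf : 0 ≤ rf) (hrfδ : rf ≤ δ)
    (himp : ∀ r : ℝ, rf ≤ r → r ≤ δ → SmallField U (r / S) → SmallField U (max rf (θ * r) / S)) (hU : SmallField U (δ / S)) :
    ∀ m : ℕ, SmallField U (max rf (θ ^ m * δ) / S) := by
  have hδ : 0 ≤ δ := hrf.trans hrfδ
  intro m
  induction m with
  | zero =>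
    refine MinimalActionRate.SmallField.mono hU (div_le_div_of_nonneg_right ?_ hS.le)
    rw [pow_zero, one_mul]; exact le_max_right _ _
  | succ m ih =>
    -- the current radius `r = max rf (θ^m δ)` lies in `[rf, δ]`
    have hθm : θ ^ m ≤ 1 := pow_le_one₀ hθ0 hθ1
    have hr2 : max rf (θ ^ m * δ) ≤ δ :=
      max_le hrfδ (by nlinarith [pow_nonneg hθ0 m])
    have hstep := himp _ (le_max_left _ _) hr2 ih
    refine MinimalActionRate.SmallField.mono hstep (div_le_div_of_nonneg_right (max_le (le_max_left _ _) ?_) hS.le)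
    -- `θ · max rf (θ^m δ) ≤ max rf (θ^{m+1} δ)`
    rcases le_total rf (θ ^ m * δ) with h | h
    · rw [max_eq_right h, ← mul_assoc, ← pow_succ']
      exact le_max_right _ _
    · rw [max_eq_left h]
      exact (le_max_left _ _).trans' (by nlinarith)

/-- **DOWN TO THE FLOOR**: with `0 ≤ θ < 1` and `0 < rf ≤ δ`, the iteration reaches `SmallField U (rf∕S)` («we continue this way until we reach the bound B₃ε₁»).
[cite: Balaban1985Variational, Prop. 8 p.304] -/
theorem smallField_floor_of_improvement {U : Site d → Fin d → (Matrix n n ℂ)ˣ} {S rf θ δ : ℝ} (hS : 0 < S) (hθ0 : 0 ≤ θ) (hθ1 : θ < 1)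
    (hrf : 0 < rf) (hrfδ : rf ≤ δ)
    (himp : ∀ r : ℝ, rf ≤ r → r ≤ δ → SmallField U (r / S) → SmallField U (max rf (θ * r) / S)) (hU : SmallField U (δ / S)) :
    SmallField U (rf / S) := by
  have hδ : 0 < δ := lt_of_lt_of_le hrf hrfδ
  -- some power of `θ` brings `θ^m δ` below `rf`
  obtain ⟨m, hm⟩ := exists_pow_lt_of_lt_one (div_pos hrf hδ) hθ1
  have hm' : θ ^ m * δ ≤ rf := by
    have := (lt_div_iff₀ hδ).mp hm
    exact this.le
  have h := smallField_iterate_of_improvement hS hθ0 hθ1.le hrf.le hrfδ himp hU m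
  rwa [max_eq_left hm'] at h

/-! ## §2 On the data class: `hape` of F31 ∕ F33 from the contractive local improvement -/

/-- **`hape` ⇐ A ONE-SHOT CONTRACTIVE IMPROVEMENT ON THE DATA CLASS** ([Balaban1985Variational] Prop. 8's iteration, p. 304): if every tangent-critical admissible `U`
over a datum of `𝒟_β` at level `k+1` with `SmallField U (r∕M²)`, `r ∈ [rf, δ]`, has `SmallField U (max rf (θr)∕M²)` (`0 ≤ θ < 1`, `0 < rf ≤ δ`), then every such `U`
with `SmallField U (δ∕M²)` has `SmallField U (δ₁∕M²)` for any `δ₁ ≥ rf` — literally the hypothesis `hape` of `NE7OneStepOfRoutePi.oneStep_of_dataClass_ape_routePi`.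
[cite: Balaban1985Variational, Prop. 8 p.304] -/
theorem hape_of_contractiveImprovement {L N : ℕ} (hL : 1 ≤ L) {ε δ δ₁ β rf θ : ℝ} (hθ0 : 0 ≤ θ) (hθ1 : θ < 1) (hrf : 0 < rf) (hrfδ₁ : rf ≤ δ₁)
    (hδ₁δ : δ₁ ≤ δ)
    (himp : ∀ D : Site d → Fin d → (Matrix n n ℂ)ˣ, IsUnitaryCfg D → IsPeriodicCfg D (N : ℤ) → SmallField D (4 * (Real.exp β - 1)) →
      ∀ (k : ℕ), ∀ U ∈ admissible (sfClass d L N ε) L (k + 1) D,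
      (∀ φ : Site d → Fin d → Matrix n n ℂ, IsSkewDir φ → IsPeriodicDir φ ((N * L ^ (k + 1) : ℕ) : ℤ) → TangentIter L k U φ →
        dAction U φ (perWin d (N * L ^ (k + 1))) = 0) →
      ∀ r : ℝ, rf ≤ r → r ≤ δ → SmallField U (r / ((L : ℝ) ^ (k + 1)) ^ 2) →
        SmallField U (max rf (θ * r) / ((L : ℝ) ^ (k + 1)) ^ 2)) :
    ∀ D : Site d → Fin d → (Matrix n n ℂ)ˣ, IsUnitaryCfg D → IsPeriodicCfg D (N : ℤ) → SmallField D (4 * (Real.exp β - 1)) →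
      ∀ (k : ℕ), ∀ U ∈ admissible (sfClass d L N ε) L (k + 1) D, SmallField U (δ / ((L : ℝ) ^ (k + 1)) ^ 2) →
      (∀ φ : Site d → Fin d → Matrix n n ℂ, IsSkewDir φ → IsPeriodicDir φ ((N * L ^ (k + 1) : ℕ) : ℤ) → TangentIter L k U φ →
        dAction U φ (perWin d (N * L ^ (k + 1))) = 0) → SmallField U (δ₁ / ((L : ℝ) ^ (k + 1)) ^ 2) := by
  intro D hDu hDP hDs k U hU hUδ hcrit
  have hLpos : (0 : ℝ) < L := by exact_mod_cast (by omega : 0 < L)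
  have hS : 0 < ((L : ℝ) ^ (k + 1)) ^ 2 := by positivity
  have hfloor := smallField_floor_of_improvement hS hθ0 hθ1 hrf (hrfδ₁.trans hδ₁δ) (himp D hDu hDP hDs k U hU hcrit) hUδ
  exact MinimalActionRate.SmallField.mono hfloor (div_le_div_of_nonneg_right hrfδ₁ hS.le)

end

end Summit.QuantumFields.BalabanUV.T4Continuum.NE7ApeOfHalvingIteration
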